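import Mathlib
import HarnessLib
import Literature.Analysis.Convex.BrowderApproximants
import Literature.Analysis.Convex.HalpernIteration

/-!
# Browder's approximants converge in every real Hilbert space: Halpern's monotonicity proof
[Hal67, Thm 1]; Browder's fixed point theorem for nonexpansive maps [Bro65, Thms 1, 3]

Analysis/Convex file (everything PROVED; no named facts, no `sorry`).

The tree's `BrowderApproximants` proves BROWDER's theorem [Bro67, Thm 1] / [Kör15, Thms 1.1–1.2]
— the approximants `z_t = t u + (1 − t) T z_t` (`t ∈ (0, 1]`) of a nonexpansive `T` with
`Fix T ≠ ∅` converge strongly to `P_{Fix T}(u)` as `t → 0⁺` — in a PROPER (finite-dimensional)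
real inner product space, replacing Browder's weak-compactness/demiclosedness step by norm
compactness. This file removes that restriction and proves the theorem in an ARBITRARY REAL
HILBERT SPACE (`[CompleteSpace E]`; no compactness, no weak topology), following HALPERN's "new
proof of a result of Browder" [Hal67, Thm 1, p. 958]. Halpern (unit ball `B`, anchor `0`,
`y_k = k f(y_k)`): for `0 < k < l ≤ 1` and `d = y_l − y_k`, nonexpansiveness of `f` gives his
inequality (1), "consequently `(y_k, d) ≥ 0`", and then
(2) `‖y_l‖² ≥ ‖y_k‖² + ‖y_l − y_k‖²`; "the sequence `‖y_{l_i}‖`, being monotonic and bounded,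
converges. Hence `‖y_{l_i} − y_{k_i}‖² ≤ ‖y_{l_i}‖² − ‖y_{k_i}‖² → 0`. Thus `y_{k_i}` converges to
some `q`", which is a fixed point by continuity of `f`; and since "(2) holds with `p = y_l`,
`l = 1`" for every fixed point `p`, `‖q‖ ≤ ‖p‖`: `q` is the fixed point of smallest norm. In the
tree's anchored parametrisation (`z_t − u = (1 − t)(T z_t − u)`, i.e. `k = 1 − t`,
`y_k = z_t − u` for the map `x ↦ T(x + u) − u`) this reads: `⟨z_t − u, z_s − z_t⟩ ≥ 0` and
`‖z_t − u‖² + ‖z_s − z_t‖² ≤ ‖z_s − u‖²` for `0 < s ≤ t ≤ 1`; in particular `t ↦ ‖z_t − u‖` is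
antitone on `(0, 1]`, and a Browder path is norm-Cauchy as `t → 0⁺` as soon as it is bounded.

As corollaries we obtain, in every real Hilbert space, BROWDER's fixed point theorem
[Bro65, Thm 1] — "Let `C` be a closed bounded convex subset of `H`, `T` a contraction
[= nonexpansive] map of `C` into `C`. Then `T` has a fixed point in `C`." (Browder's own proof
there also runs through the approximants `u_r = r T u_r`, concluding with the closedness of
`(I − T)(C)` for monotone `I − T`) — its Leray–Schauder-type companion [Bro65, Thm 3] for balls,
Browder's Thm 1 of [Bro67] under Browder's hypotheses, and Halpern's Theorem 1 as printed.

## Contents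

* Halpern's inequalities along a Browder path (any real inner product space): `apply_one_eq`
  (`z_1 = u`), `sub_anchor_eq_smul` (`z_t − u = (1 − t)(T z_t − u)`),
  `inner_sub_anchor_sub_nonneg` ([Hal67, (1)] ⇒ `⟨z_t − u, z_s − z_t⟩ ≥ 0`),
  `norm_sub_anchor_sq_add_norm_sub_sq_le` ([Hal67, (2)]), `norm_sub_anchor_le_norm_sub_anchor`,
  `antitoneOn_norm_sub_anchor`, and the fixed-point form
  `norm_sub_anchor_sq_add_norm_fixedPoint_sub_sq_le` (`‖z_t − u‖² + ‖p − z_t‖² ≤ ‖p − u‖²`,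
  "(2) with `l = 1`"), `norm_sub_anchor_le_two_mul` (`‖z_t − u‖ ≤ 2‖u − p‖`).
* Complete space: `exists_forall_norm_sub_lt` (the Cauchy criterion on `(0, t₀]` from a bound
  `‖z_t − u‖ ≤ R`), `exists_tendsto_of_norm_sub_anchor_le` (the strong limit exists),
  `apply_eq_of_tendsto` (a limit of a Browder path is a fixed point), `eq_proj_of_tendsto` (it is
  `P_{Fix T}(u)`), and the MAIN THEOREMS `tendsto_proj_fixedPoints_of_norm_sub_anchor_le`
  (a bounded Browder path forces `Fix T ≠ ∅` and converges to `P_{Fix T}(u)`),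
  `tendsto_proj_fixedPoints_of_nonempty` (**[Bro67, Thm 1] = [Kör15, Thm 1.2] in every real
  Hilbert space**: `Fix T ≠ ∅ ⇒ z_t → P_{Fix T}(u)` as `t → 0⁺`),
  `fixedPoints_nonempty_iff_exists_bound`, the a posteriori estimate `norm_sub_proj_sq_le`
  (`‖z_t − P u‖² ≤ ‖P u − u‖² − ‖z_t − u‖²`), Browder's parametrisation `λ → 1⁻`
  (`tendsto_proj_fixedPoints_of_browder_param`, [Kör15, Thm 1.1]).
* [Bro67, Thm 1] with Browder's hypotheses (`C` bounded closed convex, `T(C) ⊆ C`, `u ∈ C`):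
  `tendsto_proj_fixedPoints_of_mapsTo_isBounded` (`z_t ∈ C`, `z_t → P_{Fix T}(u) ∈ C`); Browder's
  FIXED POINT THEOREM [Bro65, Thm 1]: `exists_fixedPoint_of_mapsTo` (`T` nonexpansive on `E`) and
  `exists_fixedPoint_of_nonexpansiveOn` (`T` nonexpansive on `C` only; we extend by `T ∘ P_C`
  where Browder extends by Kirszbraun's theorem); [Bro65, Thm 3] `exists_fixedPoint_of_ne_smul`
  (ball `‖x‖ ≤ r` about `0`, `T : C → H` nonexpansive with `T x ≠ λ x` for `‖x‖ = r`, `λ > 1`,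
  via the radial retraction `proj_closedBall_eq_smul`); HALPERN's THEOREM 1 as printed,
  `halpern_theorem_one` (unit ball, `y_k = k T y_k`, `k → 1⁻`, the limit is the unique fixed
  point of smallest norm), with the existence and uniqueness of his approximants `y_k ∈ B`
  (`halpern_existsUnique_approximant`).

## Deviations (stated, not hidden)

* `T` is a map `E → E` throughout; where the source has `T : C → C` (resp. `f : B → B`) only the
  restriction to `C` enters the hypotheses (`∀ x ∈ C, ∀ y ∈ C, ‖T x − T y‖ ≤ ‖x − y‖`,
  `MapsTo T C C`) and the values of `T` off `C` are irrelevant.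
* Halpern allows `|k| < 1`; we take `k ∈ [0, 1)` and the one-sided limit `k → 1⁻` (`𝓝[<] 1`),
  which is the content of his Theorem 1 (his proof treats increasing sequences `k_i → 1`).
* No rates: Halpern's proof, like Browder's, is ineffective ([Kör15] extracts rates of
  metastability; not transcribed).

## Mathlib / tree search (dedup)

Mathlib v4.32.0 has `ContractingWith.fixedPoint` (Banach) and no Browder–Göhde–Kirk / Browder /
Halpern theorem for nonexpansive maps (`lean search 'Göhde|Gohde|nonexpansive.*fixed point
property|Halpern1967|Browder1965'`: tree docstrings only). Tree: `BrowderApproximants` (the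
proper-space theorem `IsBrowderPath.tendsto_proj_fixedPoints` and `fixedPoints_nonempty_of_mapsTo`
via Schauder; its a priori estimates `IsBrowderPath.sub_eq`, `norm_sub_fixedPoint_le`,
`sub_apply_eq`, `norm_sub_fixedPoint_sq_le_inner`, `mem_of_mapsTo` and `exists_isBrowderPath` are
USED here, not re-proved), `HalpernIteration` (`continuous_of_nonexpansive`,
`isClosed_fixedPoints_of_nonexpansive`, `convex_fixedPoints` [GK90, Lemma 3.4], used),
`ConvexMetricProjection` (`proj`, `proj_mem`, `proj_eq_self`, `norm_sub_proj_le`,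
`eq_proj_of_norm_sub_le`, `norm_proj_sub_proj_le` [Deu01], used), `ViscosityApproximation` and
`MinimalDisplacement` (different objects), `KirszbraunValentine` (Browder's extension step in
[Bro65]; not needed here).

References: [Hal67] Halpern 1967 (Bull. AMS 73, 957–961), Thm 1 and its proof, (1)–(3), p. 958;
[Bro65] Browder 1965 (Proc. Nat. Acad. Sci. 53, 1272–1276), Thms 1 and 3, p. 1274; [Bro67] Browder
1967 (Arch. Rational Mech. Anal. 24, 82–90), Thm 1; [Kör15] Körnlein 2015, Thms 1.1–1.2; [GK90]
Goebel–Kirk 1990, Lemma 3.4; [Deu01] Deutsch 2001, Thms 2.4, 4.1, 5.5.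
-/

noncomputable section

open Filter Topology Set Function Metric
open scoped RealInnerProductSpace

namespace Literature.Analysis.Convex.BrowderCurveStrongConvergence

open Literature.Analysis.Convex.ConvexMetricProjection
open Literature.Analysis.Convex.BrowderApproximants
open Literature.Analysis.Convex.HalpernIteration

variable {E : Type*} [NormedAddCommGroup E] [InnerProductSpace ℝ E]
variable {T : E → E} {u p : E} {z : ℝ → E} {s t : ℝ}

/-! ## Halpern's inequalities along a Browder path (any real inner product space) -/

/-- At `t = 1` the approximant is the anchor, `z_1 = u` (Halpern: `y_0 = 0`).
[cite: Halpern1967, Thm 1 (proof)] [cite: Kornlein2015, §1, Thm 1.2] -/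
theorem apply_one_eq (h : IsBrowderPath T u z) : z 1 = u := by
  have e := h one_pos le_rfl
  rw [sub_self, zero_smul, add_zero, one_smul] at e
  exact e

/-- `z_t − u = (1 − t)(T z_t − u)`: Halpern's `y_k = k f(y_k)` with `k = 1 − t`, written around
the anchor `u`. [cite: Halpern1967, Thm 1 (proof, (3))] [cite: Kornlein2015, §1, Thm 1.2] -/
theorem sub_anchor_eq_smul (h : IsBrowderPath T u z) (ht0 : 0 < t) (ht1 : t ≤ 1) :
    z t - u = (1 - t) • (T (z t) - u) := by
  rw [h.sub_eq ht0 ht1 u, sub_self, smul_zero, zero_add]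

/-- **Halpern's inequality (1) and its consequence `(y_k, d) ≥ 0`**: for a Browder path of a
nonexpansive `T` and `0 < s ≤ t ≤ 1`, `⟨z_t − u, z_s − z_t⟩ ≥ 0`. Proof (Halpern's, anchored):
`(s − t)(z_t − u) + (1 − t)(z_s − z_t) = (1 − t)(1 − s)(T z_s − T z_t)` has norm at most
`(1 − t)(1 − s)‖z_s − z_t‖ ≤ (1 − t)‖z_s − z_t‖`; expanding the square gives
`2(t − s)(1 − t)⟨z_t − u, z_s − z_t⟩ ≥ (s − t)²‖z_t − u‖² + (1 − t)²(1 − (1 − s)²)‖z_s − z_t‖² ≥ 0`.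
[cite: Halpern1967, Thm 1 (proof, (1))] -/
theorem inner_sub_anchor_sub_nonneg (h : IsBrowderPath T u z)
    (hT : ∀ x y, ‖T x - T y‖ ≤ ‖x - y‖) (hs0 : 0 < s) (hst : s ≤ t) (ht1 : t ≤ 1) :
    0 ≤ ⟪z t - u, z s - z t⟫ := by
  rcases hst.eq_or_lt with rfl | hst'
  · simp
  rcases ht1.eq_or_lt with rfl | ht1'
  · simp [apply_one_eq h]
  have ht0 : 0 < t := hs0.trans hst'
  have hy := sub_anchor_eq_smul h ht0 ht1
  have hw := sub_anchor_eq_smul h hs0 (hst.trans ht1)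
  have key : (s - t) • (z t - u) + (1 - t) • (z s - z t) =
      ((1 - t) * (1 - s)) • (T (z s) - T (z t)) := by
    have e1 : z s - z t = (z s - u) - (z t - u) := by abel
    rw [e1, hw, hy]
    module
  have h1t : 0 < 1 - t := by linarith
  have h1s : 0 ≤ 1 - s := by linarith
  have hc : 0 ≤ (1 - t) * (1 - s) := mul_nonneg h1t.le h1s
  have hnorm : ‖(s - t) • (z t - u) + (1 - t) • (z s - z t)‖ ≤
      (1 - t) * (1 - s) * ‖z s - z t‖ := by
    rw [key, norm_smul, Real.norm_of_nonneg hc]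
    exact mul_le_mul_of_nonneg_left (hT (z s) (z t)) hc
  have hexp : ‖(s - t) • (z t - u) + (1 - t) • (z s - z t)‖ ^ 2 =
      (s - t) ^ 2 * ‖z t - u‖ ^ 2 + 2 * ((s - t) * (1 - t)) * ⟪z t - u, z s - z t⟫ +
        (1 - t) ^ 2 * ‖z s - z t‖ ^ 2 := by
    rw [norm_add_sq_real, norm_smul, norm_smul, real_inner_smul_left, real_inner_smul_right,
      Real.norm_eq_abs, Real.norm_eq_abs, mul_pow, mul_pow, sq_abs, sq_abs]
    ring
  have hsq : ‖(s - t) • (z t - u) + (1 - t) • (z s - z t)‖ ^ 2 ≤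
      ((1 - t) * (1 - s) * ‖z s - z t‖) ^ 2 := pow_le_pow_left₀ (norm_nonneg _) hnorm 2
  rw [hexp] at hsq
  have hs1' : 0 ≤ 1 - (1 - s) ^ 2 := by nlinarith
  have hprod : 0 ≤ (t - s) * (1 - t) * ⟪z t - u, z s - z t⟫ := by
    nlinarith [mul_nonneg (mul_nonneg (sq_nonneg (1 - t)) hs1') (sq_nonneg ‖z s - z t‖),
      mul_nonneg (sq_nonneg (s - t)) (sq_nonneg ‖z t - u‖)]
  exact (mul_nonneg_iff_of_pos_left (mul_pos (by linarith) h1t)).1 hprod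

/-- **Halpern's inequality (2)**, `‖y_l‖² ≥ ‖y_k‖² + ‖y_l − y_k‖²`: for `0 < s ≤ t ≤ 1`,
`‖z_t − u‖² + ‖z_s − z_t‖² ≤ ‖z_s − u‖²`. [cite: Halpern1967, Thm 1 (proof, (2))] -/
theorem norm_sub_anchor_sq_add_norm_sub_sq_le (h : IsBrowderPath T u z)
    (hT : ∀ x y, ‖T x - T y‖ ≤ ‖x - y‖) (hs0 : 0 < s) (hst : s ≤ t) (ht1 : t ≤ 1) :
    ‖z t - u‖ ^ 2 + ‖z s - z t‖ ^ 2 ≤ ‖z s - u‖ ^ 2 := by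
  have e : z s - u = (z t - u) + (z s - z t) := by abel
  rw [e, norm_add_sq_real]
  linarith [inner_sub_anchor_sub_nonneg h hT hs0 hst ht1]

/-- "The sequence `‖y_{l_i}‖`, being monotonic": `‖z_t − u‖ ≤ ‖z_s − u‖` for `0 < s ≤ t ≤ 1`.
[cite: Halpern1967, Thm 1 (proof, (2))] -/
theorem norm_sub_anchor_le_norm_sub_anchor (h : IsBrowderPath T u z)
    (hT : ∀ x y, ‖T x - T y‖ ≤ ‖x - y‖) (hs0 : 0 < s) (hst : s ≤ t) (ht1 : t ≤ 1) :
    ‖z t - u‖ ≤ ‖z s - u‖ := by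
  have h1 := norm_sub_anchor_sq_add_norm_sub_sq_le h hT hs0 hst ht1
  have h2 : ‖z t - u‖ ^ 2 ≤ ‖z s - u‖ ^ 2 := by linarith [sq_nonneg ‖z s - z t‖]
  exact (sq_le_sq₀ (norm_nonneg _) (norm_nonneg _)).1 h2

/-- `t ↦ ‖z_t − u‖` is antitone on `(0, 1]` (the distance to the anchor increases as `t ↓ 0`).
[cite: Halpern1967, Thm 1 (proof, (2))] -/
theorem antitoneOn_norm_sub_anchor (h : IsBrowderPath T u z)
    (hT : ∀ x y, ‖T x - T y‖ ≤ ‖x - y‖) : AntitoneOn (fun t => ‖z t - u‖) (Ioc 0 1) :=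
  fun _ hs _ ht hst => norm_sub_anchor_le_norm_sub_anchor h hT hs.1 hst ht.2

/-- **(2) with `l = 1`** (the fixed-point form): for every fixed point `p` and `t ∈ (0, 1]`,
`‖z_t − u‖² + ‖p − z_t‖² ≤ ‖p − u‖²` (equivalently `⟨p − z_t, z_t − u⟩ ≥ 0`, which is the tree's
key inequality `‖z_t − p‖² ≤ ⟨u − p, z_t − p⟩`). [cite: Halpern1967, Thm 1 (proof, "(2) holds with
p = y_l, l = 1")] [cite: Browder1967, Thm 1 (proof)] -/
theorem norm_sub_anchor_sq_add_norm_fixedPoint_sub_sq_le (h : IsBrowderPath T u z)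
    (hT : ∀ x y, ‖T x - T y‖ ≤ ‖x - y‖) (hp : T p = p) (ht0 : 0 < t) (ht1 : t ≤ 1) :
    ‖z t - u‖ ^ 2 + ‖p - z t‖ ^ 2 ≤ ‖p - u‖ ^ 2 := by
  have key := h.norm_sub_fixedPoint_sq_le_inner hT hp ht0 ht1
  have e2 : ⟪p - z t, z t - u⟫ = ⟪u - p, z t - p⟫ - ‖z t - p‖ ^ 2 := by
    have e3 : z t - u = (z t - p) - (u - p) := by abel
    have e4 : p - z t = -(z t - p) := by abel
    rw [e3, e4, inner_neg_left, inner_sub_right, real_inner_self_eq_norm_sq,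
      real_inner_comm (z t - p) (u - p)]
    ring
  have e : p - u = (p - z t) + (z t - u) := by abel
  rw [e, norm_add_sq_real]
  linarith

/-- Boundedness when a fixed point exists: `‖z_t − u‖ ≤ 2‖u − p‖` (from `‖z_t − p‖ ≤ ‖u − p‖`).
[cite: Browder1967, Thm 1 (proof)] [cite: Halpern1967, Thm 1 (proof, "monotonic and bounded")] -/
theorem norm_sub_anchor_le_two_mul (h : IsBrowderPath T u z)
    (hT : ∀ x y, ‖T x - T y‖ ≤ ‖x - y‖) (hp : T p = p) (ht0 : 0 < t) (ht1 : t ≤ 1) :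
    ‖z t - u‖ ≤ 2 * ‖u - p‖ := by
  have h1 := h.norm_sub_fixedPoint_le hT hp ht0 ht1
  calc ‖z t - u‖ = ‖(z t - p) + (p - u)‖ := by rw [sub_add_sub_cancel]
    _ ≤ ‖z t - p‖ + ‖p - u‖ := norm_add_le _ _
    _ ≤ ‖u - p‖ + ‖u - p‖ := by rw [norm_sub_rev p u]; gcongr
    _ = 2 * ‖u - p‖ := by ring

/-! ## Strong convergence in a complete space: Halpern's proof of Browder's theorem -/

/-- **The Cauchy criterion** ("`‖y_{l_i} − y_{k_i}‖² ≤ ‖y_{l_i}‖² − ‖y_{k_i}‖² → 0`"): if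
`‖z_t − u‖ ≤ R` on `(0, 1]`, then for every `ε > 0` there is `t₀ ∈ (0, 1]` with
`‖z_s − z_t‖ < ε` for all `s, t ∈ (0, t₀]` (take `t₀` with `‖z_{t₀} − u‖² > sup − ε²`).
[cite: Halpern1967, Thm 1 (proof)] -/
theorem exists_forall_norm_sub_lt (h : IsBrowderPath T u z)
    (hT : ∀ x y, ‖T x - T y‖ ≤ ‖x - y‖) {R : ℝ}
    (hR : ∀ ⦃t : ℝ⦄, 0 < t → t ≤ 1 → ‖z t - u‖ ≤ R) {ε : ℝ} (hε : 0 < ε) :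
    ∃ t₀ : ℝ, 0 < t₀ ∧ t₀ ≤ 1 ∧
      ∀ ⦃s t : ℝ⦄, 0 < s → s ≤ t₀ → 0 < t → t ≤ t₀ → ‖z s - z t‖ < ε := by
  obtain ⟨S, hS⟩ : ∃ S : Set ℝ, S = (fun r => ‖z r - u‖ ^ 2) '' Ioc (0 : ℝ) 1 := ⟨_, rfl⟩
  have hmem : ∀ ⦃r : ℝ⦄, 0 < r → r ≤ 1 → ‖z r - u‖ ^ 2 ∈ S := fun r hr0 hr1 => by
    rw [hS]; exact mem_image_of_mem _ ⟨hr0, hr1⟩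
  have hSne : S.Nonempty := ⟨_, hmem one_pos le_rfl⟩
  have hSbdd : BddAbove S := by
    refine ⟨R ^ 2, fun x hx => ?_⟩
    rw [hS] at hx
    obtain ⟨r, hr, rfl⟩ := hx
    exact pow_le_pow_left₀ (norm_nonneg _) (hR hr.1 hr.2) 2
  have hlt' : sSup S - ε ^ 2 < sSup S := by linarith [pow_pos hε 2]
  obtain ⟨x, hx, hlt⟩ := exists_lt_of_lt_csSup hSne hlt'
  rw [hS] at hx
  obtain ⟨t₀, ht₀, hx'⟩ := hx
  have hlt₀ : sSup S - ε ^ 2 < ‖z t₀ - u‖ ^ 2 := lt_of_lt_of_eq hlt hx'.symm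
  refine ⟨t₀, ht₀.1, ht₀.2, ?_⟩
  have main : ∀ ⦃a b : ℝ⦄, 0 < a → a ≤ b → b ≤ t₀ → ‖z a - z b‖ ^ 2 < ε ^ 2 := by
    intro a b ha hab hb
    have hb1 : b ≤ 1 := hb.trans ht₀.2
    have h1 := norm_sub_anchor_sq_add_norm_sub_sq_le h hT ha hab hb1
    have h2 : ‖z a - u‖ ^ 2 ≤ sSup S := le_csSup hSbdd (hmem ha (hab.trans hb1))
    have h3 := norm_sub_anchor_sq_add_norm_sub_sq_le h hT (ha.trans_le hab) hb ht₀.2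
    linarith [sq_nonneg ‖z b - z t₀‖]
  intro s t hs0 hst₀ ht0 htt₀
  rcases le_total s t with hst | hts
  · exact lt_of_pow_lt_pow_left₀ 2 hε.le (main hs0 hst htt₀)
  · rw [norm_sub_rev]
    exact lt_of_pow_lt_pow_left₀ 2 hε.le (main ht0 hts hst₀)

/-- **The strong limit exists** ("thus `y_{k_i}` converges to some `q`"): in a complete space a
Browder path with `‖z_t − u‖` bounded on `(0, 1]` converges strongly as `t → 0⁺`.
[cite: Halpern1967, Thm 1 (proof)] -/
theorem exists_tendsto_of_norm_sub_anchor_le [CompleteSpace E] (h : IsBrowderPath T u z)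
    (hT : ∀ x y, ‖T x - T y‖ ≤ ‖x - y‖) {R : ℝ}
    (hR : ∀ ⦃t : ℝ⦄, 0 < t → t ≤ 1 → ‖z t - u‖ ≤ R) :
    ∃ q : E, Tendsto z (𝓝[>] 0) (𝓝 q) := by
  rw [← cauchy_map_iff_exists_tendsto, Metric.cauchy_iff]
  refine ⟨inferInstance, fun ε hε => ?_⟩
  obtain ⟨t₀, ht₀0, -, hC⟩ := exists_forall_norm_sub_lt h hT hR hε
  refine ⟨z '' Ioc 0 t₀, image_mem_map (Ioc_mem_nhdsGT ht₀0), ?_⟩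
  rintro _ ⟨s, hs, rfl⟩ _ ⟨t, ht, rfl⟩
  rw [dist_eq_norm]
  exact hC hs.1 hs.2 ht.1 ht.2

/-- **A strong limit of a Browder path is a fixed point** ("if we take the limit of both sides of
(3) `y_{k_i} = k_i f(y_{k_i})` … `q` is a fixed point of `f`"): from `z_t − T z_t = t(u − T z_t)`
and the continuity of `T`. [cite: Halpern1967, Thm 1 (proof, (3))]
[cite: Browder1967, Thm 1 (proof)] -/
theorem apply_eq_of_tendsto (h : IsBrowderPath T u z) (hT : ∀ x y, ‖T x - T y‖ ≤ ‖x - y‖)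
    {q : E} (hq : Tendsto z (𝓝[>] 0) (𝓝 q)) : T q = q := by
  have hTz : Tendsto (fun t => T (z t)) (𝓝[>] 0) (𝓝 (T q)) :=
    ((continuous_of_nonexpansive hT).tendsto q).comp hq
  have h1 : Tendsto (fun t => z t - T (z t)) (𝓝[>] 0) (𝓝 (q - T q)) := hq.sub hTz
  have hid : Tendsto (fun t : ℝ => t) (𝓝[>] (0 : ℝ)) (𝓝 0) :=
    tendsto_id'.2 nhdsWithin_le_nhds
  have h2 : Tendsto (fun t : ℝ => t • (u - T (z t))) (𝓝[>] 0) (𝓝 0) := by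
    have h2' : Tendsto (fun t : ℝ => t • (u - T (z t))) (𝓝[>] 0) (𝓝 ((0 : ℝ) • (u - T q))) :=
      hid.smul (tendsto_const_nhds.sub hTz)
    rwa [zero_smul] at h2'
  have hIoc : Ioc (0 : ℝ) 1 ∈ 𝓝[>] (0 : ℝ) := Ioc_mem_nhdsGT one_pos
  have h3 : Tendsto (fun t => z t - T (z t)) (𝓝[>] 0) (𝓝 0) := by
    refine h2.congr' ?_
    filter_upwards [hIoc] with t ht
    exact (h.sub_apply_eq ht.1 ht.2).symm
  have h4 : q - T q = 0 := tendsto_nhds_unique h1 h3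
  exact (sub_eq_zero.1 h4).symm

/-- **The limit is the nearest fixed point** ("`‖q‖ ≤ ‖p‖` … `‖q‖ = inf ‖p‖`, `p` a fixed point
of `f`"): a strong limit `q` of a Browder path satisfies `‖u − q‖ ≤ ‖u − p‖` for every fixed point
`p` (pass to the limit in "(2) with `l = 1`"), hence `q = P_{Fix T}(u)`.
[cite: Halpern1967, Thm 1 (proof)] [cite: Browder1967, Thm 1 ("the fixed point of `S` closest to
`u₀`")] -/
theorem eq_proj_of_tendsto [CompleteSpace E] (h : IsBrowderPath T u z)
    (hT : ∀ x y, ‖T x - T y‖ ≤ ‖x - y‖) {q : E} (hq : Tendsto z (𝓝[>] 0) (𝓝 q)) :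
    q = proj (fixedPoints T) u := by
  have hKc : IsComplete (fixedPoints T) := (isClosed_fixedPoints_of_nonexpansive hT).isComplete
  have hKv : Convex ℝ (fixedPoints T) := convex_fixedPoints hT
  have hTq : T q = q := apply_eq_of_tendsto h hT hq
  have hqK : q ∈ fixedPoints T := mem_fixedPoints_iff.2 hTq
  refine eq_proj_of_norm_sub_le ⟨q, hqK⟩ hKc hKv hqK fun p hp => ?_
  have hp' : T p = p := mem_fixedPoints_iff.1 hp
  have hIoc : Ioc (0 : ℝ) 1 ∈ 𝓝[>] (0 : ℝ) := Ioc_mem_nhdsGT one_pos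
  have hle : ∀ᶠ t in 𝓝[>] (0 : ℝ), ‖u - z t‖ ≤ ‖u - p‖ := by
    filter_upwards [hIoc] with t ht
    have h1 := norm_sub_anchor_sq_add_norm_fixedPoint_sub_sq_le h hT hp' ht.1 ht.2
    have h2 : ‖z t - u‖ ^ 2 ≤ ‖p - u‖ ^ 2 := by linarith [sq_nonneg ‖p - z t‖]
    rw [norm_sub_rev u (z t), norm_sub_rev u p]
    exact (sq_le_sq₀ (norm_nonneg _) (norm_nonneg _)).1 h2
  have hlim : Tendsto (fun t => ‖u - z t‖) (𝓝[>] (0 : ℝ)) (𝓝 ‖u - q‖) :=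
    (tendsto_const_nhds.sub hq).norm
  exact le_of_tendsto hlim hle

/-- **Main theorem, bounded form** (Halpern's proof in full): in a real Hilbert space, a Browder
path of a nonexpansive `T` with `‖z_t − u‖` bounded on `(0, 1]` converges strongly, as `t → 0⁺`,
to `P_{Fix T}(u)`; in particular `T` HAS a fixed point ("the existence of `y` will be
established in the course of the proof"). [cite: Halpern1967, Thm 1] [cite: Browder1967, Thm 1] -/
theorem tendsto_proj_fixedPoints_of_norm_sub_anchor_le [CompleteSpace E]
    (h : IsBrowderPath T u z) (hT : ∀ x y, ‖T x - T y‖ ≤ ‖x - y‖) {R : ℝ}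
    (hR : ∀ ⦃t : ℝ⦄, 0 < t → t ≤ 1 → ‖z t - u‖ ≤ R) :
    (fixedPoints T).Nonempty ∧ Tendsto z (𝓝[>] 0) (𝓝 (proj (fixedPoints T) u)) := by
  obtain ⟨q, hq⟩ := exists_tendsto_of_norm_sub_anchor_le h hT hR
  have hTq : T q = q := apply_eq_of_tendsto h hT hq
  have heq : q = proj (fixedPoints T) u := eq_proj_of_tendsto h hT hq
  refine ⟨⟨q, mem_fixedPoints_iff.2 hTq⟩, ?_⟩
  rw [← heq]
  exact hq

/-- **Browder's theorem [Bro67, Thm 1] / [Kör15, Thm 1.2] in EVERY real Hilbert space** (no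
compactness): for `T` nonexpansive with `Fix T ≠ ∅` and a Browder path `z_t = t u + (1 − t) T z_t`,
`z_t → P_{Fix T}(u)` — the fixed point of `T` nearest to `u` — strongly as `t → 0⁺`. This lifts
the tree's proper-space `BrowderApproximants.IsBrowderPath.tendsto_proj_fixedPoints`.
[cite: Browder1967, Thm 1] [cite: Halpern1967, Thm 1] [cite: Kornlein2015, §1, Thms 1.1–1.2] -/
theorem tendsto_proj_fixedPoints_of_nonempty [CompleteSpace E] (h : IsBrowderPath T u z)
    (hT : ∀ x y, ‖T x - T y‖ ≤ ‖x - y‖) (hne : (fixedPoints T).Nonempty) :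
    Tendsto z (𝓝[>] 0) (𝓝 (proj (fixedPoints T) u)) := by
  obtain ⟨p, hp⟩ := hne
  have hp' : T p = p := mem_fixedPoints_iff.1 hp
  exact (tendsto_proj_fixedPoints_of_norm_sub_anchor_le h hT
    (fun t ht0 ht1 => norm_sub_anchor_le_two_mul h hT hp' ht0 ht1)).2

/-- `T` has a fixed point iff its Browder path (from any anchor) is bounded on `(0, 1]`.
[cite: Halpern1967, Thm 1 (proof)] [cite: Browder1967, Thm 1 (proof)] -/
theorem fixedPoints_nonempty_iff_exists_bound [CompleteSpace E] (h : IsBrowderPath T u z)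
    (hT : ∀ x y, ‖T x - T y‖ ≤ ‖x - y‖) :
    (fixedPoints T).Nonempty ↔ ∃ R : ℝ, ∀ ⦃t : ℝ⦄, 0 < t → t ≤ 1 → ‖z t - u‖ ≤ R := by
  constructor
  · rintro ⟨p, hp⟩
    exact ⟨2 * ‖u - p‖, fun t ht0 ht1 =>
      norm_sub_anchor_le_two_mul h hT (mem_fixedPoints_iff.1 hp) ht0 ht1⟩
  · rintro ⟨R, hR⟩
    exact (tendsto_proj_fixedPoints_of_norm_sub_anchor_le h hT hR).1

/-- **A posteriori estimate**: with `q = P_{Fix T}(u)`, `‖z_t − q‖² ≤ ‖q − u‖² − ‖z_t − u‖²`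
for `t ∈ (0, 1]` ("(2) with `l = 1`" at the limit point; the right-hand side tends to `0`).
[cite: Halpern1967, Thm 1 (proof, (2))] -/
theorem norm_sub_proj_sq_le [CompleteSpace E] (h : IsBrowderPath T u z)
    (hT : ∀ x y, ‖T x - T y‖ ≤ ‖x - y‖) (hne : (fixedPoints T).Nonempty) (ht0 : 0 < t)
    (ht1 : t ≤ 1) :
    ‖z t - proj (fixedPoints T) u‖ ^ 2 ≤
      ‖proj (fixedPoints T) u - u‖ ^ 2 - ‖z t - u‖ ^ 2 := by
  have hKc : IsComplete (fixedPoints T) := (isClosed_fixedPoints_of_nonexpansive hT).isComplete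
  have hq : T (proj (fixedPoints T) u) = proj (fixedPoints T) u :=
    mem_fixedPoints_iff.1 (proj_mem hne hKc (convex_fixedPoints hT) u)
  have h1 := norm_sub_anchor_sq_add_norm_fixedPoint_sub_sq_le h hT hq ht0 ht1
  rw [norm_sub_rev (z t) (proj (fixedPoints T) u)]
  linarith

/-- The change of parameter `λ = 1 − t`: `λ → 1⁻` corresponds to `t → 0⁺`. [folklore] -/
private theorem tendsto_one_sub_nhdsLT :
    Tendsto (fun l : ℝ => 1 - l) (𝓝[<] (1 : ℝ)) (𝓝[>] 0) := by
  refine tendsto_nhdsWithin_iff.2 ⟨?_, ?_⟩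
  · have hc : Tendsto (fun l : ℝ => 1 - l) (𝓝 (1 : ℝ)) (𝓝 (1 - 1)) :=
      tendsto_const_nhds.sub tendsto_id
    rw [sub_self] at hc
    exact hc.mono_left nhdsWithin_le_nhds
  · exact eventually_nhdsWithin_of_forall fun l hl => by
      simp only [mem_Iio] at hl; simp only [mem_Ioi]; linarith

/-- **Browder's theorem in Browder's parametrisation [Kör15, Thm 1.1], every real Hilbert space**:
if `x_λ = λ T x_λ + (1 − λ) u` for `λ ∈ [0, 1)` and `Fix T ≠ ∅`, then `x_λ → P_{Fix T}(u)` as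
`λ → 1⁻`. [cite: Browder1967, Thm 1] [cite: Kornlein2015, §1, Thm 1.1] [cite: Halpern1967, Thm 1] -/
theorem tendsto_proj_fixedPoints_of_browder_param [CompleteSpace E] {x : ℝ → E}
    (hx : ∀ ⦃l : ℝ⦄, 0 ≤ l → l < 1 → x l = l • T (x l) + (1 - l) • u)
    (hT : ∀ x y, ‖T x - T y‖ ≤ ‖x - y‖) (hne : (fixedPoints T).Nonempty) :
    Tendsto x (𝓝[<] 1) (𝓝 (proj (fixedPoints T) u)) := by
  have hz : IsBrowderPath T u (fun t => x (1 - t)) := by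
    intro t ht0 ht1
    have e := hx (l := 1 - t) (by linarith) (by linarith)
    calc x (1 - t) = (1 - t) • T (x (1 - t)) + (1 - (1 - t)) • u := e
      _ = t • u + (1 - t) • T (x (1 - t)) := by rw [sub_sub_cancel, add_comm]
  have hcomp := (tendsto_proj_fixedPoints_of_nonempty hz hT hne).comp tendsto_one_sub_nhdsLT
  refine hcomp.congr fun l => ?_
  simp only [Function.comp_apply, sub_sub_cancel]

/-! ## Browder's hypotheses: a bounded closed convex invariant set (every real Hilbert space) -/

/-- **[Bro67, Thm 1] with Browder's hypotheses, in every real Hilbert space**: `T` nonexpansive,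
`C` bounded closed convex with `T(C) ⊆ C`, `u ∈ C`, `z` a Browder path. Then `z_t ∈ C` for
`t ∈ (0, 1]` (so the path is bounded), and `z_t → P_{Fix T}(u) ∈ C` strongly as `t → 0⁺` — no
fixed point is assumed. Lifts the tree's proper-space `tendsto_proj_fixedPoints_of_mapsTo`.
[cite: Browder1967, Thm 1] [cite: Kornlein2015, §1, Thm 1.1] [cite: Halpern1967, Thm 1] -/
theorem tendsto_proj_fixedPoints_of_mapsTo_isBounded [CompleteSpace E] (h : IsBrowderPath T u z)
    (hT : ∀ x y, ‖T x - T y‖ ≤ ‖x - y‖) {C : Set E} (hCconv : Convex ℝ C) (hCcl : IsClosed C)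
    (hCbd : Bornology.IsBounded C) (hu : u ∈ C) (hmaps : MapsTo T C C) :
    (∀ ⦃t : ℝ⦄, 0 < t → t ≤ 1 → z t ∈ C) ∧
      Tendsto z (𝓝[>] 0) (𝓝 (proj (fixedPoints T) u)) ∧ proj (fixedPoints T) u ∈ C := by
  have hmem : ∀ ⦃t : ℝ⦄, 0 < t → t ≤ 1 → z t ∈ C := fun t ht0 ht1 =>
    h.mem_of_mapsTo hT hCconv hCcl hu hmaps ht0 ht1
  obtain ⟨R, hR⟩ := hCbd.subset_closedBall u
  have hR' : ∀ ⦃t : ℝ⦄, 0 < t → t ≤ 1 → ‖z t - u‖ ≤ R := fun t ht0 ht1 => by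
    have h1 := hR (hmem ht0 ht1)
    rwa [mem_closedBall, dist_eq_norm] at h1
  have hlim := (tendsto_proj_fixedPoints_of_norm_sub_anchor_le h hT hR').2
  refine ⟨hmem, hlim, hCcl.mem_of_tendsto hlim ?_⟩
  have hIoc : Ioc (0 : ℝ) 1 ∈ 𝓝[>] (0 : ℝ) := Ioc_mem_nhdsGT one_pos
  filter_upwards [hIoc] with t ht
  exact hmem ht.1 ht.2

/-- **Browder's fixed point theorem [Bro65, Thm 1], for `T` nonexpansive on `E`**: in a real
Hilbert space, a nonexpansive map sending a nonempty bounded closed convex set `C` into itself has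
a fixed point in `C` (namely `P_{Fix T}(u)` for any `u ∈ C`, the limit of the Browder path from
`u`; Browder: "`T_r u = r T u` … has a fixed point `u_r` in `C` by the Picard iteration argument.
Then `f u_r = (1 − r) T u_r → 0` as `r → 1`"). Lifts the tree's proper-space
`BrowderApproximants.fixedPoints_nonempty_of_mapsTo` (Schauder). [cite: Browder1965, Thm 1]
[cite: Halpern1967, §Introduction ("Browder [1] has established that such maps always possess
at least one fixed point")] -/
theorem exists_fixedPoint_of_mapsTo [CompleteSpace E] (hT : ∀ x y, ‖T x - T y‖ ≤ ‖x - y‖)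
    {C : Set E} (hCconv : Convex ℝ C) (hCcl : IsClosed C) (hCbd : Bornology.IsBounded C)
    (hCne : C.Nonempty) (hmaps : MapsTo T C C) : ∃ p ∈ C, T p = p := by
  obtain ⟨u, hu⟩ := hCne
  obtain ⟨z, hz⟩ := exists_isBrowderPath hT u
  obtain ⟨-, hlim, hmemP⟩ :=
    tendsto_proj_fixedPoints_of_mapsTo_isBounded hz hT hCconv hCcl hCbd hu hmaps
  exact ⟨_, hmemP, apply_eq_of_tendsto hz hT hlim⟩

/-- Extension device: if `T` is nonexpansive on a nonempty closed convex `C`, then `T ∘ P_C` is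
nonexpansive on `E` (since `P_C` is nonexpansive [Deu01, Thm 5.5]) and agrees with `T` on `C`.
[folklore] -/
private theorem norm_comp_proj_sub_le [CompleteSpace E] {C : Set E} (hCconv : Convex ℝ C)
    (hCcl : IsClosed C) (hCne : C.Nonempty)
    (hT : ∀ x ∈ C, ∀ y ∈ C, ‖T x - T y‖ ≤ ‖x - y‖) (x y : E) :
    ‖(T ∘ proj C) x - (T ∘ proj C) y‖ ≤ ‖x - y‖ :=
  (hT _ (proj_mem hCne hCcl.isComplete hCconv x) _ (proj_mem hCne hCcl.isComplete hCconv y)).trans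
    (norm_proj_sub_proj_le hCne hCcl.isComplete hCconv x y)

/-- **Browder's fixed point theorem [Bro65, Thm 1] as stated** ("Let `C` be a closed bounded convex
subset of `H`, `T` a contraction map of `C` into `C`. Then `T` has a fixed point in `C`."; Browder's
"contraction" = nonexpansive, his (1)): here `T` need only be nonexpansive ON `C`. Proof: apply
`exists_fixedPoint_of_mapsTo` to the nonexpansive extension `T ∘ P_C` (Browder extends `T` to `H`
by Kirszbraun's theorem instead). [cite: Browder1965, Thm 1] -/
theorem exists_fixedPoint_of_nonexpansiveOn [CompleteSpace E] {C : Set E} (hCconv : Convex ℝ C)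
    (hCcl : IsClosed C) (hCbd : Bornology.IsBounded C) (hCne : C.Nonempty)
    (hT : ∀ x ∈ C, ∀ y ∈ C, ‖T x - T y‖ ≤ ‖x - y‖) (hmaps : MapsTo T C C) :
    ∃ p ∈ C, T p = p := by
  have hKc : IsComplete C := hCcl.isComplete
  have hT' : ∀ x y, ‖(T ∘ proj C) x - (T ∘ proj C) y‖ ≤ ‖x - y‖ :=
    norm_comp_proj_sub_le hCconv hCcl hCne hT
  have hmaps' : MapsTo (T ∘ proj C) C C := fun x hx => by
    rw [comp_apply, proj_eq_self hCne hKc hCconv hx]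
    exact hmaps hx
  obtain ⟨p, hpC, hp⟩ := exists_fixedPoint_of_mapsTo hT' hCconv hCcl hCbd hCne hmaps'
  rw [comp_apply, proj_eq_self hCne hKc hCconv hpC] at hp
  exact ⟨p, hpC, hp⟩

/-- The metric projection onto the ball `‖x‖ ≤ r` is the radial retraction: for `‖y‖ > r > 0`,
`P_C(y) = (r/‖y‖) y` — Browder's retraction `R u = r u/‖u‖` (`‖u‖ ≥ r`) in the proof of
[Bro65, Thm 3]. [cite: Browder1965, Thm 3 (proof)] [cite: Deutsch2001, Thm 2.4] -/
theorem proj_closedBall_eq_smul [CompleteSpace E] {r : ℝ} (hr : 0 < r) {y : E} (hy : r < ‖y‖) :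
    proj (closedBall (0 : E) r) y = (r / ‖y‖) • y := by
  have hKc : IsComplete (closedBall (0 : E) r) := isClosed_closedBall.isComplete
  have hy0 : 0 < ‖y‖ := hr.trans hy
  symm
  refine eq_proj_of_norm_sub_le ⟨0, mem_closedBall_self hr.le⟩ hKc (convex_closedBall 0 r) ?_
    fun w hw => ?_
  · rw [mem_closedBall_zero_iff, norm_smul, norm_div, Real.norm_of_nonneg hr.le, norm_norm]
    exact (div_mul_cancel₀ r hy0.ne').le
  · rw [mem_closedBall_zero_iff] at hw
    have e : y - (r / ‖y‖) • y = (1 - r / ‖y‖) • y := by rw [sub_smul, one_smul]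
    have h1 : 0 ≤ 1 - r / ‖y‖ := by
      rw [sub_nonneg, div_le_one hy0]
      exact hy.le
    rw [e, norm_smul, Real.norm_of_nonneg h1, sub_mul, one_mul, div_mul_cancel₀ r hy0.ne']
    linarith [norm_sub_norm_le y w]

/-- **[Bro65, Thm 3]** (Leray–Schauder boundary condition): let `C` be the closed ball of radius
`r > 0` about `0` in a real Hilbert space and `T` nonexpansive on `C` (values in `E`) such that
`T x ≠ λ x` for every `x` with `‖x‖ = r` and every `λ > 1`. Then `T` has a fixed point in `C`.
Browder's proof: `T₁ = R ∘ T` (`R` the radial retraction, nonexpansive) maps `C` into `C`, so has a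
fixed point `p ∈ C` by Thm 1; if `‖T p‖ ≤ r` then `T p = p`, otherwise `‖p‖ = r` and
`T p = (‖T p‖/r) p` with `‖T p‖/r > 1`, excluded. [cite: Browder1965, Thm 3] -/
theorem exists_fixedPoint_of_ne_smul [CompleteSpace E] {r : ℝ} (hr : 0 < r)
    (hT : ∀ x ∈ closedBall (0 : E) r, ∀ y ∈ closedBall (0 : E) r, ‖T x - T y‖ ≤ ‖x - y‖)
    (hLS : ∀ x : E, ‖x‖ = r → ∀ c : ℝ, 1 < c → T x ≠ c • x) :
    ∃ p ∈ closedBall (0 : E) r, T p = p := by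
  have hKc : IsComplete (closedBall (0 : E) r) := isClosed_closedBall.isComplete
  have hCne : (closedBall (0 : E) r).Nonempty := ⟨0, mem_closedBall_self hr.le⟩
  have hCconv : Convex ℝ (closedBall (0 : E) r) := convex_closedBall 0 r
  have hT₁ : ∀ x ∈ closedBall (0 : E) r, ∀ y ∈ closedBall (0 : E) r,
      ‖(proj (closedBall (0 : E) r) ∘ T) x - (proj (closedBall (0 : E) r) ∘ T) y‖ ≤ ‖x - y‖ :=
    fun x hx y hy => (norm_proj_sub_proj_le hCne hKc hCconv (T x) (T y)).trans (hT x hx y hy)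
  have hmaps : MapsTo (proj (closedBall (0 : E) r) ∘ T) (closedBall 0 r) (closedBall 0 r) :=
    fun x _ => proj_mem hCne hKc hCconv (T x)
  obtain ⟨p, hpC, hp⟩ := exists_fixedPoint_of_nonexpansiveOn hCconv isClosed_closedBall
    isBounded_closedBall hCne hT₁ hmaps
  rw [comp_apply] at hp
  refine ⟨p, hpC, ?_⟩
  by_cases hTp : ‖T p‖ ≤ r
  · rwa [proj_eq_self hCne hKc hCconv (mem_closedBall_zero_iff.2 hTp)] at hp
  · exfalso
    rw [not_le] at hTp
    rw [proj_closedBall_eq_smul hr hTp] at hp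
    have hTp0 : 0 < ‖T p‖ := hr.trans hTp
    have hnp : ‖p‖ = r := by
      rw [← hp, norm_smul, norm_div, Real.norm_of_nonneg hr.le, norm_norm,
        div_mul_cancel₀ r hTp0.ne']
    have hc : 1 < ‖T p‖ / r := (one_lt_div hr).2 hTp
    have hsc : ‖T p‖ / r * (r / ‖T p‖) = 1 := by
      rw [div_mul_div_comm, mul_comm ‖T p‖ r, div_self (mul_ne_zero hr.ne' hTp0.ne')]
    refine hLS p hnp (‖T p‖ / r) hc ?_
    calc T p = (‖T p‖ / r * (r / ‖T p‖)) • T p := by rw [hsc, one_smul]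
      _ = (‖T p‖ / r) • ((r / ‖T p‖) • T p) := by rw [smul_smul]
      _ = (‖T p‖ / r) • p := by rw [hp]

/-! ## Halpern's Theorem 1 as printed -/

/-- Halpern's approximants exist and are unique ("if `g : B → B` is defined by `g(x) = k f(x)`
with `|k| < 1` then `‖g(x) − g(y)‖ ≤ |k|‖x − y‖` … consequently there exists a unique point
`y_k ∈ B` such that `y_k = g(y_k) = k f(y_k)`"): for `T` nonexpansive on the unit ball `B` with
`T(B) ⊆ B` and `k ∈ [0, 1)` there is a unique `y ∈ B` with `y = k T y` (real Hilbert space).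
[cite: Halpern1967, §Definitions and preliminary observations (p. 958)] -/
theorem halpern_existsUnique_approximant [CompleteSpace E]
    (hT : ∀ x ∈ closedBall (0 : E) 1, ∀ y ∈ closedBall (0 : E) 1, ‖T x - T y‖ ≤ ‖x - y‖)
    (hmaps : MapsTo T (closedBall (0 : E) 1) (closedBall (0 : E) 1)) {k : ℝ} (hk0 : 0 ≤ k)
    (hk1 : k < 1) :
    ∃ y ∈ closedBall (0 : E) 1, y = k • T y ∧
      ∀ y' ∈ closedBall (0 : E) 1, y' = k • T y' → y' = y := by
  have hKc : IsComplete (closedBall (0 : E) 1) := isClosed_closedBall.isComplete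
  have hBne : (closedBall (0 : E) 1).Nonempty := ⟨0, mem_closedBall_self zero_le_one⟩
  have hBconv : Convex ℝ (closedBall (0 : E) 1) := convex_closedBall 0 1
  have hT' : ∀ a b, ‖(T ∘ proj (closedBall (0 : E) 1)) a - (T ∘ proj (closedBall (0 : E) 1)) b‖
      ≤ ‖a - b‖ := norm_comp_proj_sub_le hBconv isClosed_closedBall hBne hT
  have hTeq : ∀ ⦃x : E⦄, x ∈ closedBall (0 : E) 1 →
      (T ∘ proj (closedBall (0 : E) 1)) x = T x := fun x hx => by
    rw [comp_apply, proj_eq_self hBne hKc hBconv hx]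
  have hmaps' : MapsTo (T ∘ proj (closedBall (0 : E) 1)) (closedBall 0 1) (closedBall 0 1) :=
    fun x hx => by rw [hTeq hx]; exact hmaps hx
  obtain ⟨z, hz⟩ := exists_isBrowderPath hT' (0 : E)
  have ht0 : 0 < 1 - k := by linarith
  have ht1 : 1 - k ≤ 1 := by linarith
  have hzB : z (1 - k) ∈ closedBall (0 : E) 1 :=
    hz.mem_of_mapsTo hT' hBconv isClosed_closedBall (mem_closedBall_self zero_le_one) hmaps' ht0
      ht1
  refine ⟨z (1 - k), hzB, ?_, fun y' hy'B hy' => ?_⟩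
  · have e := hz ht0 ht1
    rw [smul_zero, zero_add, sub_sub_cancel, hTeq hzB] at e
    exact e
  · -- uniqueness in `B`: `‖y' − y‖ = k‖T y' − T y‖ ≤ k‖y' − y‖`
    have e := hz ht0 ht1
    rw [smul_zero, zero_add, sub_sub_cancel, hTeq hzB] at e
    have h1 : ‖y' - z (1 - k)‖ ≤ k * ‖y' - z (1 - k)‖ := by
      have e2 : y' - z (1 - k) = k • (T y' - T (z (1 - k))) := by
        rw [smul_sub, ← hy', ← e]
      calc ‖y' - z (1 - k)‖ = k * ‖T y' - T (z (1 - k))‖ := by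
            rw [e2, norm_smul, Real.norm_of_nonneg hk0]
        _ ≤ k * ‖y' - z (1 - k)‖ := mul_le_mul_of_nonneg_left (hT _ hy'B _ hzB) hk0
    have h2 : ‖y' - z (1 - k)‖ ≤ 0 := by nlinarith [norm_nonneg (y' - z (1 - k))]
    exact sub_eq_zero.1 (norm_le_zero_iff.1 h2)

/-- **[Hal67, Theorem 1]** ("Let `f : B → B` be a nonexpanding map [`B` the unit ball of a real
Hilbert space] and `y_k` the unique element of `B` satisfying `y_k = k f(y_k)` for `|k| < 1`. Then
`lim_{k → 1} y_k = y` where `y` is the unique fixed point of `f` with the smallest norm."): here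
`T : E → E` is nonexpansive on `B = closedBall 0 1` and `y_k ∈ B` satisfies `y_k = k T y_k`
for `k ∈ [0, 1)` (such `y_k` exist uniquely when `T(B) ⊆ B`, `halpern_existsUnique_approximant`;
the invariance is not needed below); then there is `q ∈ B` with `T q = q`, `‖q‖ ≤ ‖p‖` for every
fixed point `p ∈ B` of `T`, `q` is the UNIQUE fixed point in `B` of smallest norm, and `y_k → q`
strongly as `k → 1⁻`. Proof: `t ↦ y_{1−t}` is a bounded Browder path, anchored at `0`, of the
nonexpansive extension `T ∘ P_B`. [cite: Halpern1967, Thm 1] -/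
theorem halpern_theorem_one [CompleteSpace E]
    (hT : ∀ x ∈ closedBall (0 : E) 1, ∀ y ∈ closedBall (0 : E) 1, ‖T x - T y‖ ≤ ‖x - y‖)
    {y : ℝ → E} (hyB : ∀ ⦃k : ℝ⦄, 0 ≤ k → k < 1 → y k ∈ closedBall (0 : E) 1)
    (hy : ∀ ⦃k : ℝ⦄, 0 ≤ k → k < 1 → y k = k • T (y k)) :
    ∃ q ∈ closedBall (0 : E) 1, T q = q ∧
      (∀ p ∈ closedBall (0 : E) 1, T p = p → ‖q‖ ≤ ‖p‖) ∧
      (∀ p ∈ closedBall (0 : E) 1, T p = p → ‖p‖ ≤ ‖q‖ → p = q) ∧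
      Tendsto y (𝓝[<] 1) (𝓝 q) := by
  have hKc : IsComplete (closedBall (0 : E) 1) := isClosed_closedBall.isComplete
  have hBne : (closedBall (0 : E) 1).Nonempty := ⟨0, mem_closedBall_self zero_le_one⟩
  have hBconv : Convex ℝ (closedBall (0 : E) 1) := convex_closedBall 0 1
  -- the nonexpansive extension `T' = T ∘ P_B`
  have hT' : ∀ a b, ‖(T ∘ proj (closedBall (0 : E) 1)) a - (T ∘ proj (closedBall (0 : E) 1)) b‖
      ≤ ‖a - b‖ := norm_comp_proj_sub_le hBconv isClosed_closedBall hBne hT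
  have hTeq : ∀ ⦃x : E⦄, x ∈ closedBall (0 : E) 1 →
      (T ∘ proj (closedBall (0 : E) 1)) x = T x := fun x hx => by
    rw [comp_apply, proj_eq_self hBne hKc hBconv hx]
  -- `t ↦ y (1 − t)` is a Browder path of `T'` anchored at `0`, bounded by `1`
  have hz : IsBrowderPath (T ∘ proj (closedBall (0 : E) 1)) 0 (fun t => y (1 - t)) := by
    intro t ht0 ht1
    have hk0 : 0 ≤ 1 - t := by linarith
    have hk1 : 1 - t < 1 := by linarith
    show y (1 - t) = t • (0 : E) + (1 - t) • (T ∘ proj (closedBall (0 : E) 1)) (y (1 - t))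
    rw [hTeq (hyB hk0 hk1), smul_zero, zero_add]
    exact hy hk0 hk1
  have hR : ∀ ⦃t : ℝ⦄, 0 < t → t ≤ 1 → ‖(fun t => y (1 - t)) t - 0‖ ≤ 1 := fun t ht0 ht1 => by
    show ‖y (1 - t) - 0‖ ≤ 1
    rw [sub_zero]
    exact mem_closedBall_zero_iff.1 (hyB (by linarith) (by linarith))
  obtain ⟨hne, hlim⟩ := tendsto_proj_fixedPoints_of_norm_sub_anchor_le hz hT' hR
  -- the fixed point set of the extension
  have hFc : IsComplete (fixedPoints (T ∘ proj (closedBall (0 : E) 1))) :=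
    (isClosed_fixedPoints_of_nonexpansive hT').isComplete
  have hFv : Convex ℝ (fixedPoints (T ∘ proj (closedBall (0 : E) 1))) := convex_fixedPoints hT'
  have hmemF : ∀ ⦃p : E⦄, p ∈ closedBall (0 : E) 1 → T p = p →
      p ∈ fixedPoints (T ∘ proj (closedBall (0 : E) 1)) := fun p hpB hp => by
    rw [mem_fixedPoints_iff, hTeq hpB]
    exact hp
  obtain ⟨q, hq⟩ : ∃ q, q = proj (fixedPoints (T ∘ proj (closedBall (0 : E) 1))) 0 := ⟨_, rfl⟩
  rw [← hq] at hlim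
  have hIoc : Ioc (0 : ℝ) 1 ∈ 𝓝[>] (0 : ℝ) := Ioc_mem_nhdsGT one_pos
  have hqB : q ∈ closedBall (0 : E) 1 := by
    refine isClosed_closedBall.mem_of_tendsto hlim ?_
    filter_upwards [hIoc] with t ht
    exact hyB (by linarith [ht.2]) (by linarith [ht.1])
  have hTq : T q = q := by
    rw [← hTeq hqB]
    exact apply_eq_of_tendsto hz hT' hlim
  have hmin : ∀ p ∈ closedBall (0 : E) 1, T p = p → ‖q‖ ≤ ‖p‖ := fun p hpB hp => by
    have h1 := norm_sub_proj_le hne hFc hFv (0 : E) (hmemF hpB hp)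
    rwa [← hq, zero_sub, zero_sub, norm_neg, norm_neg] at h1
  refine ⟨q, hqB, hTq, hmin, fun p hpB hp hle => ?_, ?_⟩
  · -- uniqueness of the fixed point of smallest norm
    have hpF := hmemF hpB hp
    have h1 : p = proj (fixedPoints (T ∘ proj (closedBall (0 : E) 1))) 0 :=
      eq_proj_of_norm_sub_le hne hFc hFv hpF fun w hw => by
        rw [zero_sub, zero_sub, norm_neg, norm_neg]
        have h2 := norm_sub_proj_le hne hFc hFv (0 : E) hw
        rw [← hq, zero_sub, zero_sub, norm_neg, norm_neg] at h2
        exact hle.trans h2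
    rw [h1, hq]
  · -- `k → 1⁻` is `t = 1 − k → 0⁺`
    have hcomp := hlim.comp tendsto_one_sub_nhdsLT
    refine hcomp.congr fun l => ?_
    simp only [Function.comp_apply, sub_sub_cancel]

end Literature.Analysis.Convex.BrowderCurveStrongConvergence

end
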